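import Literature.Probability.LatticeModels.VillainNishimoriGauge
import Literature.Probability.LatticeModels.VillainKernelPoisson
import Literature.MathematicalPhysics.QuantumLattice.HeatKernelGroupCircleKernelProofs
import HarnessLib

/-!
# Trigonometric moments of the Villain bond law and the Nishimori path identity (Villain case)

C. Garban, T. Spencer, J. Math. Phys. **63** (2022) 093302 = arXiv:2109.01617, §2 Step 1,
(2.5), (2.7)–(2.8) and the first display of the proof of Lemma 2.5 — for the VILLAIN interaction
(Remark 10).  PROVED here:

* `integral_coe_zpow_mul_villainKernel_arg`, `villainBondZ_eq`, `villainBond_moment` — the Fourier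
  coefficients of the single-bond Villain law: `∫ zⁿ v_K(arg z) dz = e^{-n²/(2K)}/√(2πK)`,
  `Z_K = (2πK)^{-1/2}`, `𝔼_K[zⁿ] = e^{-n²/(2K)}` (term-wise integration of the character series
  `hasSum_villainKernel_fourier_circle`); in particular the first moment is
  `λ_K = e^{-1/(2K)} = villainMean K`;
* `BondSystem.villainDisorderAvg_holonomy` — `𝔼_K[U_T] = λ_K^{|T|₁}` for unit chains `T`;
* `BondSystem.villainDisorderAvg_holonomy_mul_conj` — the pair bound behind Lemma 2.5,
  `0 ≤ 𝔼_K[U_T conj(U_{T'})] ≤ λ_K^{|T|₁ + |T'|₁ − 2 overlap}` (shared bonds contribute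
  `e^{0}` or `e^{-2/K} ≤ 1`, bonds used once `λ_K`);
* `BondSystem.villainDisorderAvg_villainCExpect_diff_mul_holonomy` — **(2.8)**:
  `𝔼_K[⟨θ̄_x θ_y⟩_{u,K} · U_T(u)] = λ_K^{|T|₁}` (telescoping + Lemma 2.1).

## References

* C. Garban, T. Spencer, J. Math. Phys. 63 (2022) 093302, arXiv:2109.01617: (2.5), (2.7), (2.8),
  proof of Lemma 2.5 (first display), Remark 10. [GarbanSpencer2022]
* J. Fröhlich, T. Spencer, Comm. Math. Phys. 83 (1982) 411–454, §2.1 (i) (Fourier series of the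
  Villain weight). [FrohlichSpencerCMP1982]
-/

noncomputable section

namespace Literature.Probability.LatticeModels

open MeasureTheory Finset TopologicalSpace Filter
open scoped BigOperators ComplexConjugate Topology
open Literature.MathematicalPhysics.QuantumFieldTheory

/-! ### Trigonometric moments of the single-bond Villain law -/

/-- **`∫ zⁿ v_K(arg z) dz = e^{-n²/(2K)}/√(2πK)`** (`n ∈ ℤ`, `K > 0`, Haar probability `dz` on
`U(1)`): the Fourier coefficients of the Villain kernel (term-wise integration of the character
series `v_K(arg z) = ∑ₘ (e^{-m²/(2K)}/√(2πK)) zᵐ`, `hasSum_villainKernel_fourier_circle`, and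
orthogonality). [cite: FrohlichSpencerCMP1982, §2.1 (i), §2.4 (2.19)] -/
theorem integral_coe_zpow_mul_villainKernel_arg {K : ℝ} (hK : 0 < K) (n : ℤ) :
    ∫ z, (z : ℂ) ^ n * (villainKernel K (Complex.arg (z : ℂ)) : ℂ)
        ∂Measure.haarMeasure (⊤ : PositiveCompacts Circle) =
      ((Real.exp (-((n : ℝ) ^ 2) / (2 * K)) / Real.sqrt (2 * Real.pi * K) : ℝ) : ℂ) := by
  set c : ℤ → ℂ := fun m => ((Real.exp (-((m : ℝ) ^ 2) / (2 * K)) / Real.sqrt (2 * Real.pi * K) : ℝ) : ℂ)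
    with hc
  have hexp : ∀ z : Circle, (z : ℂ) ^ n * (villainKernel K (Complex.arg (z : ℂ)) : ℂ) =
      ∑' m : ℤ, c m * (z : ℂ) ^ (m + n) := by
    intro z
    rw [← (hasSum_villainKernel_fourier_circle hK z).tsum_eq, ← tsum_mul_left]
    refine tsum_congr fun m => ?_
    rw [zpow_add₀ (Circle.coe_ne_zero z)]
    ring
  simp_rw [hexp]
  have h := Literature.MathematicalPhysics.QuantumLattice.integral_tsum_mul_coe_zpow_haarProbability_circle
    c (summable_norm_villainFourierTerm hK) (fun m => m + n) (-n)
    (fun m => by constructor <;> intro hm <;> linarith)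
  rw [show haarProbability Circle = Measure.haarMeasure (⊤ : PositiveCompacts Circle) from rfl] at h
  rw [h, hc]
  push_cast
  ring_nf

/-- **`Z_K = (2πK)^{-1/2}`**: the normalisation of the single-bond Villain law. [folklore] -/
theorem villainBondZ_eq {K : ℝ} (hK : 0 < K) : villainBondZ K = 1 / Real.sqrt (2 * Real.pi * K) := by
  have h := integral_coe_zpow_mul_villainKernel_arg hK 0
  simp only [zpow_zero, one_mul, integral_complex_ofReal, Complex.ofReal_inj, Int.cast_zero] at h
  rw [villainBondZ, h]
  norm_num

/-- The normalised trigonometric moments of the single-bond Villain law: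
`𝔼_K[zⁿ] = ∫ (v_K(arg z)/Z_K) zⁿ dz = e^{-n²/(2K)}`. [cite: GarbanSpencer2022, (2.5) with Remark 10] -/
theorem villainBond_moment {K : ℝ} (hK : 0 < K) (n : ℤ) :
    ∫ z, ((villainKernel K (Complex.arg (z : ℂ)) / villainBondZ K : ℝ) : ℂ) * (z : ℂ) ^ n
        ∂Measure.haarMeasure (⊤ : PositiveCompacts Circle) =
      ((Real.exp (-((n : ℝ) ^ 2) / (2 * K)) : ℝ) : ℂ) := by
  have hs : 0 < Real.sqrt (2 * Real.pi * K) := Real.sqrt_pos.2 (by positivity)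
  have hsC : (Real.sqrt (2 * Real.pi * K) : ℂ) ≠ 0 := by exact_mod_cast hs.ne'
  have hZ := villainBondZ_eq hK
  have e : ∀ z : Circle, ((villainKernel K (Complex.arg (z : ℂ)) / villainBondZ K : ℝ) : ℂ) * (z : ℂ) ^ n =
      ((villainBondZ K)⁻¹ : ℂ) * ((z : ℂ) ^ n * (villainKernel K (Complex.arg (z : ℂ)) : ℂ)) := by
    intro z; push_cast; ring
  simp_rw [e]
  rw [integral_const_mul, integral_coe_zpow_mul_villainKernel_arg hK n, hZ]
  push_cast
  field_simp

/-- A unit moment of the Villain bond law is a power of `λ_K`: `e^{-k²/(2K)} = λ_K^{|k|}` for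
`|k| ≤ 1`. [cite: GarbanSpencer2022, (2.5) with Remark 10] -/
theorem exp_neg_sq_div_eq_villainMean_pow (K : ℝ) {k : ℤ} (hk : k.natAbs ≤ 1) :
    Real.exp (-((k : ℝ) ^ 2) / (2 * K)) = villainMean K ^ k.natAbs := by
  rcases (show k = 0 ∨ k = 1 ∨ k = -1 by omega) with rfl | rfl | rfl
  · simp
  · simp [villainMean, neg_div]
  · simp [villainMean, neg_div]

/-- The pair-bond moment bound: for unit coefficients `k, k'`,
`e^{-(k−k')²/(2K)} ≤ λ_K^{[exactly one of k, k' is non-zero]}` (a bond used once contributes `λ_K`,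
a bond used by both chains at most `1`). [cite: GarbanSpencer2022, proof of Lemma 2.5, first display, with Remark 10] -/
theorem exp_neg_sub_sq_div_le {K : ℝ} (hK : 0 < K) {k k' : ℤ} (hk : k.natAbs ≤ 1) (hk' : k'.natAbs ≤ 1) :
    Real.exp (-(((k - k' : ℤ) : ℝ) ^ 2) / (2 * K)) ≤
      villainMean K ^ (if (k ≠ 0 ∧ k' = 0) ∨ (k = 0 ∧ k' ≠ 0) then 1 else 0) := by
  split_ifs with h
  · have hsq : ((k - k' : ℤ) : ℝ) ^ 2 = 1 := by
      rcases h with ⟨h1, h2⟩ | ⟨h1, h2⟩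
      · subst h2
        rcases (show k = 1 ∨ k = -1 by omega) with rfl | rfl <;> norm_num
      · subst h1
        rcases (show k' = 1 ∨ k' = -1 by omega) with rfl | rfl <;> norm_num
    rw [hsq, pow_one, villainMean, neg_div]
  · rw [pow_zero, Real.exp_le_one_iff, neg_div, neg_nonpos]
    positivity

namespace BondSystem

variable {V ι : Type*} [Fintype ι] (G : BondSystem V ι) {x y : V}

/-! ### Moments of holonomies under the Villain disorder -/

/-- Independence of the phases along a chain: `𝔼_K[U_T] = ∏_a e^{-T_a²/(2K)}`.
[cite: GarbanSpencer2022, §2 Step 1, with Remark 10] -/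
theorem villainDisorderAvg_holonomy_eq_prod {K : ℝ} (hK : 0 < K) (T : G.UnitChain x y) :
    villainDisorderAvg K T.holonomy =
      ∏ a, ((Real.exp (-((T.coeff a : ℝ) ^ 2) / (2 * K)) : ℝ) : ℂ) := by
  unfold UnitChain.holonomy
  rw [villainDisorderAvg_prod K (fun a z => (z : ℂ) ^ T.coeff a)]
  exact Finset.prod_congr rfl fun a _ => villainBond_moment hK (T.coeff a)

/-- `𝔼_K[U_T] = λ_K^{|T|₁}`. [cite: GarbanSpencer2022, §2 Step 1, with Remark 10] -/
theorem villainDisorderAvg_holonomy {K : ℝ} (hK : 0 < K) (T : G.UnitChain x y) :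
    villainDisorderAvg K T.holonomy = ((villainMean K ^ T.length : ℝ) : ℂ) := by
  rw [G.villainDisorderAvg_holonomy_eq_prod hK, UnitChain.length, ← Finset.prod_pow_eq_pow_sum,
    Complex.ofReal_prod]
  refine Finset.prod_congr rfl fun a _ => ?_
  rw [exp_neg_sq_div_eq_villainMean_pow K (T.natAbs_le a)]

/-- **The pair bound behind Lemma 2.5 (Villain interaction)**:
`𝔼_K[U_T · \overline{U_{T'}}] = ∏_a e^{-(T_a − T'_a)²/(2K)}` is a real number `m` with
`0 ≤ m ≤ λ_K^{symmDiffCard}`. [cite: GarbanSpencer2022, proof of Lemma 2.5, first display, with Remark 10] -/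
theorem villainDisorderAvg_holonomy_mul_conj {K : ℝ} (hK : 0 < K) (T T' : G.UnitChain x y) :
    ∃ m : ℝ, 0 ≤ m ∧ m ≤ villainMean K ^ T.symmDiffCard T' ∧
      villainDisorderAvg K (fun u => T.holonomy u * conj (T'.holonomy u)) = (m : ℂ) := by
  refine ⟨∏ a, Real.exp (-(((T.coeff a - T'.coeff a : ℤ) : ℝ) ^ 2) / (2 * K)),
    Finset.prod_nonneg fun a _ => (Real.exp_pos _).le, ?_, ?_⟩
  · unfold UnitChain.symmDiffCard
    rw [Finset.card_filter, ← Finset.prod_pow_eq_pow_sum]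
    exact Finset.prod_le_prod (fun a _ => (Real.exp_pos _).le)
      fun a _ => exp_neg_sub_sq_div_le hK (T.natAbs_le a) (T'.natAbs_le a)
  · have e : (fun u => T.holonomy u * conj (T'.holonomy u)) =
        fun u : ι → Circle => ∏ a, ((u a : Circle) : ℂ) ^ (T.coeff a - T'.coeff a) := by
      funext u
      simp only [UnitChain.holonomy, map_prod, map_zpow₀, ← Finset.prod_mul_distrib]
      refine Finset.prod_congr rfl fun a _ => ?_
      rw [← Circle.coe_inv_eq_conj, Circle.coe_inv, inv_zpow', ← zpow_add₀ (Circle.coe_ne_zero _),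
        sub_eq_add_neg]
    rw [e, villainDisorderAvg_prod K (fun a z => (z : ℂ) ^ (T.coeff a - T'.coeff a)), Complex.ofReal_prod]
    exact Finset.prod_congr rfl fun a _ => villainBond_moment hK _

variable [Fintype V]

/-- **Garban–Spencer (2.8) for the Villain interaction: the Nishimori path identity.**
`𝔼_K[⟨θ̄_x θ_y⟩_{u,K} · U_T(u)] = λ_K^{|T|₁}` for every unit chain `T` from `x` to `y`.
[cite: GarbanSpencer2022, (2.8) with Remark 10] -/
theorem villainDisorderAvg_villainCExpect_diff_mul_holonomy {K : ℝ} (hK : 0 < K) (T : G.UnitChain x y) :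
    villainDisorderAvg K (fun u => G.villainCExpect K u (fun θ => ((diffChar x y θ : Circle) : ℂ)) *
        T.holonomy u) = ((villainMean K ^ T.length : ℝ) : ℂ) := by
  have hF : Continuous fun w : ι → Circle => ∏ a, ((w a : Circle) : ℂ) ^ T.coeff a :=
    T.continuous_holonomy
  calc villainDisorderAvg K (fun u => G.villainCExpect K u (fun θ => ((diffChar x y θ : Circle) : ℂ)) *
        T.holonomy u)
      = villainDisorderAvg K (fun u => G.villainCExpect K u
          (fun θ => ∏ a, ((G.bondVar u θ a : Circle) : ℂ) ^ T.coeff a)) := by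
        congr 1; funext u
        rw [← villainCExpect_mul_const]
        simp only [T.diffChar_mul_holonomy]
    _ = villainDisorderAvg K (fun w : ι → Circle => ∏ a, ((w a : Circle) : ℂ) ^ T.coeff a) :=
        G.villainDisorderAvg_villainCExpect_bondVar hK hF
    _ = _ := G.villainDisorderAvg_holonomy hK T

end BondSystem

end Literature.Probability.LatticeModels
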